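import Literature.Analysis.ODE.HighOrderEnclosureCertificate
import Literature.Analysis.ODE.StepChain
import HarnessLib

/-!
# Kernel-checkable chains of high-order enclosure steps (continuation over a mesh)

Topic `Literature/Analysis/ODE`. R. E. Moore, *Methods and Applications of Interval Analysis*
(SIAM 1979), §8.1 p. 83: once the step `[0, t₁]` of `y' = P(y)` has been validated and the
interval value `X^{(N)}(t₁)` of (8.10) is in hand, "we can *continue* the interval solution … from
the new, *interval* initial conditions" — the test (8.5) being replaced by its interval-initial-value
form (8.13); Nedialkov–Jackson–Corliss 1999 §5, Algorithm I iterated over the mesh (validate step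
`j` from the box `Wⱼ`, hand the end enclosure over as `W_{j+1}`). This file makes the WHOLE
TRANSCRIPT of such a computation — for a polynomial field with rational data — a single `Bool`
decided by the kernel, with a soundness theorem:

* `HOEStage n` = the data of one step (order `Kⱼ`, step `hⱼ`, initial box `Wⱼ`, a-priori box
  `Sⱼ`); `HOEChainCert n` = the field `P` (term lists, `SparsePolynomialEnclosure.lean`), the list
  of stages and the claimed final box `W_N`;
* `HOEChainCert.check` runs, for every stage, the one-step certificate check of
  `HighOrderEnclosureCertificate.lean` (`HOEStepCert.check`: the HOE inclusion (8.10) ⊆ `Sⱼ` in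
  exact rational interval arithmetic) AND the landing test `endBoxⱼ ⊆ W_{j+1}` (`boxLE`), where
  `W_N` is the final box;
* `HOEChainCert.sound`: if `check = true` then from every real `y₀ ∈ W₀` a solution exists on the
  whole horizon `[0, τ_N]`, `τⱼ = h₀ + ⋯ + h_{j-1}`, and EVERY solution from `y₀` satisfies
  `y(τⱼ) ∈ Wⱼ` (`j ≤ N`), `y(t) ∈ Sⱼ` and the Taylor-tube identity with remainder in `Vⱼ` on
  `[τⱼ, τ_{j+1}]` — the abstract chain theorems `exists_solution_of_stepChain` /
  `solution_mem_of_stepChain` (`StepChain.lean`) fed with `HOEStepCert.sound` per step and with the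
  algebraic landing `∑ hʲ Φⱼ(x) + h^K v ∈ endBox ⊆ W_{j+1}` (`taylorSum_mem_hoeBox`);
  `HOEChainCert.mem_final` is the end enclosure `y(τ_N) ∈ W_N`;
* `hoeChainVerifier`: the same as a `ValidatedNumerics.Verifier` (instance = field, initial box,
  horizon, final box; certificate = the list of stages found by an untrusted integrator).

WORKED EXAMPLE (kernel): Moore's Volterra problem (8.6), `x(0) = (1, 3)`, continued over four
steps of `h = 1/8` at order `6` (`mooreVolterraChain`; the a-priori boxes and the hand-over boxes
— end boxes rounded outward to `10⁻⁷` — were produced by an untrusted search):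
`mooreVolterraChain_check : mooreVolterraChain.check = true := by decide +kernel`, whence
`mooreVolterraChain_exists` (a solution on `[0, 1/2]`) and `mooreVolterraChain_final` (every
solution from `(1,3)` has `x(1/2) ∈ [0.0589367, 0.3025851] × [2.23366, 2.327983]`). The widths of
the hand-over boxes grow by a factor ≈ 3 per step (1.2e-2, 3.7e-2, 1.0e-1, 2.4e-1): this is the
direct interval method with interval initial conditions, subject to the wrapping effect Moore
describes on pp. 83–84 (remedy 1 there, the moving coordinate system `y* + M Z`, is Lohner's QR
form of `LohnerQR.lean`, not used here). Exact rational arithmetic throughout (Moore 1966 §4.4);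
no facts, no axioms beyond the standard three, no `sorry`.

## References

* R. E. Moore, *Methods and Applications of Interval Analysis*, SIAM 1979, §8.1 eqs. (8.5),
  (8.10), (8.13) and pp. 83–84 (continuation from interval initial conditions; the wrapping
  effect). [held: lit key book:moorend-methods-applications-interval-analysis, pp. 80–84]
* N. S. Nedialkov, K. R. Jackson, G. F. Corliss, *Validated solutions of initial value problems
  for ordinary differential equations*, Appl. Math. Comput. 105 (1999) 21–68, §5 Algorithm I.
* N. S. Nedialkov, K. R. Jackson, J. D. Pryce, *An effective high-order interval method for
  validating existence and uniqueness of the solution of an IVP for an ODE*, Reliable Computing 7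
  (2001), §3.
* R. E. Moore, *Interval Analysis*, Prentice-Hall 1966, §4.4.
-/

open Set NonemptyInterval
open Literature.Analysis.ValidatedNumerics

namespace Literature.Analysis.ODE

/-! ### Stages and the chain checker -/

section Chain

variable {n : ℕ}

/-- One **stage** of a step-chain transcript: order `Kⱼ`, step `hⱼ`, the box `Wⱼ` of values at
`τⱼ` and the a-priori enclosure `Sⱼ` over `[τⱼ, τⱼ + hⱼ]` (the per-step data of Algorithm I).
[cite: NedialkovJacksonCorliss1999, §5 Algorithm I] [cite: Moore1979, §8.1 eq. (8.13)] -/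
structure HOEStage (n : ℕ) where
  /-- The order `Kⱼ ≥ 1` of the step. -/
  order : ℕ
  /-- The step size `hⱼ ≥ 0`. -/
  step : ℚ
  /-- The box `Wⱼ` of admissible values at the left mesh point. -/
  init : Fin n → NonemptyInterval ℚ
  /-- The claimed a-priori enclosure `Sⱼ` over the step. -/
  apriori : Fin n → NonemptyInterval ℚ

/-- The one-step certificate of a stage for the field `P`. [cite: Moore1979, §8.1 eqs. (8.10), (8.13)] -/
def HOEStage.toCert (P : Fin n → QMvPoly) (s : HOEStage n) : HOEStepCert n :=
  ⟨P, s.order, s.step, s.init, s.apriori⟩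

/-- The box the end enclosure of the current stage must land in: the initial box of the next
stage, or the final box after the last stage. [cite: NedialkovJacksonCorliss1999, §5 Algorithm I] -/
def nextInit (fin : Fin n → NonemptyInterval ℚ) : List (HOEStage n) → Fin n → NonemptyInterval ℚ
  | [] => fin
  | s :: _ => s.init

/-- **The chain checker** on a list of stages: every stage passes the one-step HOE certificate
check and its end box lands in the next initial box (in the final box for the last stage).
[cite: Moore1979, §8.1 eq. (8.13)] [cite: NedialkovJacksonCorliss1999, §5 Algorithm I] -/
def chainCheck (P : Fin n → QMvPoly) (fin : Fin n → NonemptyInterval ℚ) : List (HOEStage n) → Bool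
  | [] => true
  | s :: rest =>
      (s.toCert P).check && boxLE (s.toCert P).endBox (nextInit fin rest) && chainCheck P fin rest

/-- A **step-chain certificate** for a polynomial initial value problem with rational data: the
field, the stages, and the claimed enclosure `W_N` of the values at the end of the mesh.
[cite: Moore1979, §8.1 eq. (8.13)] [cite: NedialkovJacksonCorliss1999, §5 Algorithm I] -/
structure HOEChainCert (n : ℕ) where
  /-- The polynomial vector field, one term list per component. -/
  field : Fin n → QMvPoly
  /-- The stages, in temporal order. -/
  stages : List (HOEStage n)
  /-- The claimed final box `W_N ∋ y(τ_N)`. -/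
  final : Fin n → NonemptyInterval ℚ

namespace HOEChainCert

variable (c : HOEChainCert n)

/-- Number of steps `N`. [cite: NedialkovJacksonCorliss1999, §5 Algorithm I] -/
def size : ℕ := c.stages.length

/-- The padding stage used beyond the last step (order `0`, step `0`, both boxes the final box),
so that `initAt N` is the final box `W_N` of the transcript (indexing convention of this
formalisation of Algorithm I's hand-over). [cite: NedialkovJacksonCorliss1999, §5 Algorithm I] -/
def padStage : HOEStage n := ⟨0, 0, c.final, c.final⟩

/-- Stage `j` (the padding stage for `j ≥ N`). [cite: NedialkovJacksonCorliss1999, §5 Algorithm I] -/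
def stageAt (j : ℕ) : HOEStage n := c.stages.getD j c.padStage

/-- The one-step certificate of stage `j`. [cite: Moore1979, §8.1 eqs. (8.10), (8.13)] -/
def certAt (j : ℕ) : HOEStepCert n := (c.stageAt j).toCert c.field

/-- The box `Wⱼ` at mesh point `j` (`W_N` = the final box). [cite: Moore1979, §8.1 eq. (8.13)] -/
def initAt (j : ℕ) : Fin n → NonemptyInterval ℚ := (c.stageAt j).init

/-- The mesh `τⱼ = h₀ + ⋯ + h_{j-1}` (real). [cite: Moore1979, §8.1 eq. (8.13)] -/
noncomputable def mesh (j : ℕ) : ℝ := ∑ i ∈ Finset.range j, ((c.stageAt i).step : ℝ)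

/-- The mesh in exact rational arithmetic (what a verifier compares with the claimed horizon).
[cite: Moore1979, §8.1 eq. (8.13)] -/
def meshQ (j : ℕ) : ℚ := ∑ i ∈ Finset.range j, (c.stageAt i).step

/-- **The checker** of a step-chain certificate. [cite: Moore1979, §8.1 eq. (8.13)]
[cite: NedialkovJacksonCorliss1999, §5 Algorithm I] -/
def check : Bool := chainCheck c.field c.final c.stages

variable {c}

/-- The mesh starts at `τ₀ = 0`. [cite: Moore1979, §8.1 eq. (8.13)] -/
@[simp] theorem mesh_zero : c.mesh 0 = 0 := by simp [mesh]

/-- `τⱼ₊₁ = τⱼ + hⱼ`. [cite: Moore1979, §8.1 eq. (8.13)] -/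
theorem mesh_succ (j : ℕ) : c.mesh (j + 1) = c.mesh j + ((c.stageAt j).step : ℝ) := by
  simp [mesh, Finset.sum_range_succ]

/-- The length of step `j` is `hⱼ`. [cite: Moore1979, §8.1 eq. (8.13)] -/
theorem mesh_step (j : ℕ) : c.mesh (j + 1) - c.mesh j = ((c.stageAt j).step : ℝ) := by
  rw [mesh_succ, add_sub_cancel_left]

/-- The rational mesh represents the real one (exact rational bookkeeping of the checker).
[cite: Moore1966, §4.4] -/
theorem cast_meshQ (j : ℕ) : ((c.meshQ j : ℚ) : ℝ) = c.mesh j := by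
  simp [mesh, meshQ, Rat.cast_sum]

/-- Stage `N` is the padding stage (`List.getD` past the end). [folklore] -/
private theorem stageAt_size : c.stageAt c.size = c.padStage := by
  simp [stageAt, size]

/-- `W_N` is the final box of the transcript. [cite: NedialkovJacksonCorliss1999, §5 Algorithm I] -/
theorem initAt_size : c.initAt c.size = c.final := by
  rw [initAt, stageAt_size]; rfl

/-- What the chain checker establishes, stage by stage. [cite: NedialkovJacksonCorliss1999, §5 Algorithm I] -/
theorem chainCheck_spec {P : Fin n → QMvPoly} {fin : Fin n → NonemptyInterval ℚ} :
    ∀ (l : List (HOEStage n)), chainCheck P fin l = true → ∀ j < l.length,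
      ((l.getD j (⟨0, 0, fin, fin⟩ : HOEStage n)).toCert P).check = true ∧
        boxLE ((l.getD j (⟨0, 0, fin, fin⟩ : HOEStage n)).toCert P).endBox
          (l.getD (j + 1) (⟨0, 0, fin, fin⟩ : HOEStage n)).init = true
  | [], _, j, hj => absurd hj (Nat.not_lt_zero j)
  | s :: rest, h, j, hj => by
      simp only [chainCheck, Bool.and_eq_true] at h
      obtain ⟨⟨h1, h2⟩, h3⟩ := h
      cases j with
      | zero =>
          refine ⟨by simpa using h1, ?_⟩
          cases rest with
          | nil => simpa [nextInit] using h2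
          | cons s' rest' => simpa [nextInit] using h2
      | succ j =>
          simp only [List.getD_cons_succ]
          exact chainCheck_spec rest h3 j (by simpa using hj)

/-- Stage `j < N` of an accepted chain: its one-step certificate is accepted and its end box lands
in `W_{j+1}`. [cite: NedialkovJacksonCorliss1999, §5 Algorithm I] -/
theorem check_stage (hc : c.check = true) {j : ℕ} (hj : j < c.size) :
    (c.certAt j).check = true ∧ boxLE (c.certAt j).endBox (c.initAt (j + 1)) = true :=
  chainCheck_spec c.stages hc j hj

/-- The mesh of an accepted chain is nondecreasing. [cite: Moore1979, §8.1 eq. (8.13)] -/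
theorem mesh_le_succ (hc : c.check = true) {j : ℕ} (hj : j < c.size) : c.mesh j ≤ c.mesh (j + 1) := by
  rw [mesh_succ]
  exact le_add_of_nonneg_right (HOEStepCert.check_spec (check_stage hc hj).1).2.1

/-- **The landing step**: for `x ∈ Wⱼ` and `v ∈ Vⱼ`, the Taylor sum at `hⱼ` lies in `W_{j+1}`
(`∈ endBoxⱼ ⊆ W_{j+1}`). [cite: Moore1979, §8.1 eqs. (8.10), (8.13)] -/
theorem landing (hc : c.check = true) {j : ℕ} (hj : j < c.size) {x : Fin n → ℝ}
    (hx : x ∈ boxSet (castBox (c.initAt j))) {v : Fin n → ℝ}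
    (hv : v ∈ boxSet (castBox (c.certAt j).remBox)) :
    (∑ i ∈ Finset.range (c.stageAt j).order,
        ((c.stageAt j).step : ℝ) ^ i • taylorMap (fieldMv c.field) i x) +
      ((c.stageAt j).step : ℝ) ^ (c.stageAt j).order • v ∈ boxSet (castBox (c.initAt (j + 1))) := by
  obtain ⟨-, hland⟩ := check_stage hc hj
  refine boxSet_mono (castBox_mono (le_of_boxLE hland)) ?_
  rw [HOEStepCert.endBox, castBox_hoeBoxQ, ratCast_pure]
  exact taylorSum_mem_hoeBox (mem_pure_self _)
    (fun i _ => mapsTo_taylorMap_enclVec c.field i (c.stageAt j).init hx) hv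

/-- **Soundness of the step-chain certificate** (Moore 1979 §8.1 (8.13): continuation from the
interval initial conditions; NJC 1999 Algorithm I over the mesh). If `check` accepts, then from
every `y₀ ∈ W₀` a solution of `y' = P(y)` exists on `[0, τ_N]`, and EVERY solution `y` from `y₀`
on `[0, τ_N]` satisfies `y(τⱼ) ∈ Wⱼ` for `j ≤ N` and, on each `[τⱼ, τⱼ₊₁]`, `y(t) ∈ Sⱼ` and
`y(t) = ∑_{i<Kⱼ} (t-τⱼ)ⁱ Φᵢ(y(τⱼ)) + (t-τⱼ)^{Kⱼ} v` with `v ∈ Vⱼ = remBoxⱼ`.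
[cite: Moore1979, §8.1 eq. (8.13)] [cite: NedialkovJacksonCorliss1999, §5 Algorithm I] -/
theorem sound (hc : c.check = true) {y₀ : Fin n → ℝ} (hy₀ : y₀ ∈ boxSet (castBox (c.initAt 0))) :
    (∃ y : ℝ → Fin n → ℝ, y 0 = y₀ ∧
        ∀ t ∈ Icc 0 (c.mesh c.size),
          HasDerivWithinAt y (evalVec (fieldMv c.field) (y t)) (Icc 0 (c.mesh c.size)) t) ∧
      ∀ y : ℝ → Fin n → ℝ, y 0 = y₀ →
        (∀ t ∈ Icc 0 (c.mesh c.size),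
            HasDerivWithinAt y (evalVec (fieldMv c.field) (y t)) (Icc 0 (c.mesh c.size)) t) →
          (∀ j ≤ c.size, y (c.mesh j) ∈ boxSet (castBox (c.initAt j))) ∧
            ∀ j < c.size, ∀ t ∈ Icc (c.mesh j) (c.mesh (j + 1)),
              y t ∈ boxSet (castBox (c.stageAt j).apriori) ∧
                ∃ v ∈ boxSet (castBox (c.certAt j).remBox),
                  y t = (∑ i ∈ Finset.range (c.stageAt j).order,
                      (t - c.mesh j) ^ i • taylorMap (fieldMv c.field) i (y (c.mesh j))) +
                    (t - c.mesh j) ^ (c.stageAt j).order • v := by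
  -- the per-step enclosure relation of the abstract chain theorems
  set Q : ℕ → ℝ → (Fin n → ℝ) → (Fin n → ℝ) → Prop := fun j s x w =>
    w ∈ boxSet (castBox (c.stageAt j).apriori) ∧
      ∃ v ∈ boxSet (castBox (c.certAt j).remBox),
        w = (∑ i ∈ Finset.range (c.stageAt j).order, s ^ i • taylorMap (fieldMv c.field) i x) +
          s ^ (c.stageAt j).order • v with hQ
  have hτ : ∀ j < c.size, c.mesh j ≤ c.mesh (j + 1) := fun j hj => mesh_le_succ hc hj
  have hall : ∀ j < c.size, ∀ x ∈ boxSet (castBox (c.initAt j)), ∀ z : ℝ → Fin n → ℝ, z 0 = x →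
      (∀ s ∈ Icc 0 (c.mesh (j + 1) - c.mesh j),
        HasDerivWithinAt z (evalVec (fieldMv c.field) (z s)) (Icc 0 (c.mesh (j + 1) - c.mesh j)) s) →
      ∀ s ∈ Icc 0 (c.mesh (j + 1) - c.mesh j), Q j s x (z s) := by
    intro j hj x hx z hz0 hz s hs
    rw [mesh_step] at hz hs
    exact ((c.certAt j).sound (check_stage hc hj).1 hx).2 z hz0 hz s hs
  have hland : ∀ j < c.size, ∀ x ∈ boxSet (castBox (c.initAt j)), ∀ w,
      Q j (c.mesh (j + 1) - c.mesh j) x w → w ∈ boxSet (castBox (c.initAt (j + 1))) := by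
    intro j hj x hx w hw
    obtain ⟨-, v, hv, rfl⟩ := hw
    rw [mesh_step]
    exact landing hc hj hx hv
  refine ⟨?_, fun y hy0 hy => ?_⟩
  · have hstep : ∀ j < c.size, ∀ x ∈ boxSet (castBox (c.initAt j)), ∃ z : ℝ → Fin n → ℝ, z 0 = x ∧
        (∀ s ∈ Icc 0 (c.mesh (j + 1) - c.mesh j),
          HasDerivWithinAt z (evalVec (fieldMv c.field) (z s))
            (Icc 0 (c.mesh (j + 1) - c.mesh j)) s) ∧
        ∀ s ∈ Icc 0 (c.mesh (j + 1) - c.mesh j), Q j s x (z s) := by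
      intro j hj x hx
      obtain ⟨⟨z, hz0, hz⟩, -⟩ := (c.certAt j).sound (check_stage hc hj).1 hx
      refine ⟨z, hz0, ?_, ?_⟩
      · rw [mesh_step]; exact hz
      · exact hall j hj x hx z hz0 (by rw [mesh_step]; exact hz)
    obtain ⟨y, hy0, hy, -, -⟩ :=
      exists_solution_of_stepChain (f := evalVec (fieldMv c.field)) (W := fun j => boxSet (castBox (c.initAt j)))
        (Q := Q) c.size mesh_zero hτ hstep hland hy₀
    exact ⟨y, hy0, hy⟩
  · have hyW : y 0 ∈ boxSet (castBox (c.initAt 0)) := hy0 ▸ hy₀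
    obtain ⟨hW, hQ'⟩ :=
      solution_mem_of_stepChain (f := evalVec (fieldMv c.field)) (W := fun j => boxSet (castBox (c.initAt j)))
        (Q := Q) c.size mesh_zero hτ hall hland hyW hy
    exact ⟨hW, fun j hj t ht => hQ' j hj t ht⟩

/-- **The certified final box**: every solution from `y₀ ∈ W₀` on `[0, τ_N]` has `y(τ_N) ∈ W_N`.
[cite: Moore1979, §8.1 eq. (8.13)] [cite: NedialkovJacksonCorliss1999, §5 Algorithm I] -/
theorem mem_final (hc : c.check = true) {y₀ : Fin n → ℝ} (hy₀ : y₀ ∈ boxSet (castBox (c.initAt 0)))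
    {y : ℝ → Fin n → ℝ} (hy0 : y 0 = y₀)
    (hy : ∀ t ∈ Icc 0 (c.mesh c.size),
      HasDerivWithinAt y (evalVec (fieldMv c.field) (y t)) (Icc 0 (c.mesh c.size)) t) :
    y (c.mesh c.size) ∈ boxSet (castBox c.final) := by
  have h := ((sound hc hy₀).2 y hy0 hy).1 c.size le_rfl
  rwa [initAt_size] at h

end HOEChainCert

end Chain

/-! ### The chain certificate as a `Verifier` -/

section VerifierPackaging

variable {n : ℕ}

/-- A **chain instance**: field, initial box `W₀`, horizon `T` and the claimed enclosure `F` of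
the values at time `T`; the certificate is the list of stages produced by an untrusted validated
integrator (Algorithm I's "guessed" a-priori boxes and its hand-over boxes).
[cite: NedialkovJacksonCorliss1999, §5 Algorithm I] -/
structure HOEChainInstance (n : ℕ) where
  /-- The polynomial vector field. -/
  field : Fin n → QMvPoly
  /-- The box of initial values. -/
  init : Fin n → NonemptyInterval ℚ
  /-- The horizon `T`. -/
  horizon : ℚ
  /-- The claimed enclosure of `y(T)`. -/
  final : Fin n → NonemptyInterval ℚ

/-- The claim of a chain instance: from every real `y₀ ∈ W₀` a solution exists on `[0, T]`, and
every solution from `y₀` on `[0, T]` has `y(T) ∈ F`. [cite: Moore1979, §8.1 eq. (8.13)] -/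
def HOEChainInstance.Claim (I : HOEChainInstance n) : Prop :=
  ∀ y₀ ∈ boxSet (castBox I.init),
    (∃ y : ℝ → Fin n → ℝ, y 0 = y₀ ∧
        ∀ t ∈ Icc 0 (I.horizon : ℝ),
          HasDerivWithinAt y (evalVec (fieldMv I.field) (y t)) (Icc 0 (I.horizon : ℝ)) t) ∧
      ∀ y : ℝ → Fin n → ℝ, y 0 = y₀ →
        (∀ t ∈ Icc 0 (I.horizon : ℝ),
            HasDerivWithinAt y (evalVec (fieldMv I.field) (y t)) (Icc 0 (I.horizon : ℝ)) t) →
          y I.horizon ∈ boxSet (castBox I.final)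

/-- The chain certificate assembled from an instance and a list of stages.
[cite: NedialkovJacksonCorliss1999, §5 Algorithm I] -/
def HOEChainInstance.withStages (I : HOEChainInstance n) (l : List (HOEStage n)) : HOEChainCert n :=
  ⟨I.field, l, I.final⟩

/-- **The step-chain certificate as a `Verifier`**: accept iff `W₀ ⊆` the first stage's box, the
steps sum to the horizon, and the chain check passes; soundness = `HOEChainCert.sound` /
`mem_final`. [cite: Moore1979, §8.1 eq. (8.13)] [cite: NedialkovJacksonCorliss1999, §5 Algorithm I] -/
def hoeChainVerifier (n : ℕ) : Verifier (HOEChainInstance n) HOEChainInstance.Claim where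
  Cert := List (HOEStage n)
  check I l :=
    boxLE I.init ((I.withStages l).initAt 0) && decide ((I.withStages l).meshQ l.length = I.horizon) &&
      (I.withStages l).check
  sound I l h := by
    simp only [Bool.and_eq_true, decide_eq_true_eq] at h
    obtain ⟨⟨h0, hT⟩, hc⟩ := h
    have hT' : (I.horizon : ℝ) = (I.withStages l).mesh (I.withStages l).size := by
      rw [← hT, HOEChainCert.cast_meshQ]; rfl
    intro y₀ hy₀
    have hy₀' : y₀ ∈ boxSet (castBox ((I.withStages l).initAt 0)) :=
      boxSet_mono (castBox_mono (le_of_boxLE h0)) hy₀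
    refine ⟨?_, fun y hy0 hy => ?_⟩
    · obtain ⟨y, hy0, hy⟩ := (HOEChainCert.sound hc hy₀').1
      exact ⟨y, hy0, by rw [hT']; exact hy⟩
    · rw [hT'] at hy ⊢
      exact HOEChainCert.mem_final hc hy₀' hy0 hy

end VerifierPackaging

/-! ### Moore's Volterra example continued over four steps, replayed by the kernel -/

section MooreExampleChain

/-- **The transcript**: Moore's problem (8.6) (`volterraField`: `x₁' = 2x₁(1 − x₂)`,
`x₂' = −x₂(1 − x₁)`), `x(0) = (1, 3)`, four steps of `h = 1/8` at order `6`; a-priori boxes and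
hand-over boxes (end boxes rounded outward to `10⁻⁷`) from an untrusted search.
[cite: Moore1979, §8.1 eqs. (8.6)–(8.8), (8.13)] -/
def mooreVolterraChain : HOEChainCert 2 where
  field := volterraField
  stages :=
    [⟨6, 1/8, ![pure 1, pure 3],
        ![⟨(4203/10000, 744/625), by decide +kernel⟩, ⟨(5789/2000, 30271/10000), by decide +kernel⟩]⟩,
     ⟨6, 1/8, ![⟨(6049801/10000000, 6166041/10000000), by decide +kernel⟩,
          ⟨(5837991/2000000, 29240779/10000000), by decide +kernel⟩],
        ![⟨(311/1250, 7443/10000), by decide +kernel⟩, ⟨(26997/10000, 29587/10000), by decide +kernel⟩]⟩,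
     ⟨6, 1/8, ![⟨(3672581/10000000, 4045791/10000000), by decide +kernel⟩,
          ⟨(5465347/2000000, 13740541/5000000), by decide +kernel⟩],
        ![⟨(279/2000, 983/2000), by decide +kernel⟩, ⟨(24629/10000, 13917/5000), by decide +kernel⟩]⟩,
     ⟨6, 1/8, ![⟨(2068073/10000000, 1533187/5000000), by decide +kernel⟩,
          ⟨(12479017/5000000, 396181/156250), by decide +kernel⟩],
        ![⟨(223/10000, 3851/10000), by decide +kernel⟩, ⟨(4401/2000, 1287/500), by decide +kernel⟩]⟩]
  final := ![⟨(589367/10000000, 3025851/10000000), by decide +kernel⟩,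
    ⟨(111683/50000, 2327983/1000000), by decide +kernel⟩]

/-- **The kernel accepts the four-step transcript.** [cite: Moore1979, §8.1 eq. (8.13)] -/
theorem mooreVolterraChain_check : mooreVolterraChain.check = true := by
  decide +kernel

/-- The transcript has four steps. [cite: Moore1979, §8.1 eq. (8.13)] -/
theorem mooreVolterraChain_size : mooreVolterraChain.size = 4 := rfl

/-- Its horizon is `τ₄ = 1/2`. [cite: Moore1979, §8.1 eq. (8.13)] -/
theorem mooreVolterraChain_mesh : mooreVolterraChain.mesh 4 = 1 / 2 := by
  simp only [HOEChainCert.mesh, Finset.sum_range_succ, Finset.sum_range_zero, HOEChainCert.stageAt,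
    mooreVolterraChain, List.getD_cons_zero, List.getD_cons_succ]
  norm_num

/-- Moore's initial value `(1, 3)` lies in `W₀`. [cite: Moore1979, §8.1 eq. (8.6)] -/
theorem mooreVolterraChain_init_mem :
    (![1, 3] : Fin 2 → ℝ) ∈ boxSet (castBox (mooreVolterraChain.initAt 0)) := by
  rw [mem_boxSet_iff]
  intro i
  fin_cases i <;>
    simp [mooreVolterraChain, HOEChainCert.initAt, HOEChainCert.stageAt, castBox, mem_ratCast_iff]

/-- **Existence on `[0, 1/2]`** (kernel-certified): Moore's problem (8.6) with `x(0) = (1, 3)` has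
a solution on `[0, 0.5]`. [cite: Moore1979, §8.1 eqs. (8.6), (8.13)] -/
theorem mooreVolterraChain_exists :
    ∃ y : ℝ → Fin 2 → ℝ, y 0 = ![1, 3] ∧
      ∀ t ∈ Icc (0 : ℝ) (1 / 2),
        HasDerivWithinAt y (evalVec (fieldMv volterraField) (y t)) (Icc (0 : ℝ) (1 / 2)) t := by
  have h := (HOEChainCert.sound mooreVolterraChain_check mooreVolterraChain_init_mem).1
  rwa [mooreVolterraChain_size, mooreVolterraChain_mesh] at h

/-- **Enclosure at `t = 1/2`** (kernel-certified): every solution of (8.6) from `(1, 3)` on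
`[0, 0.5]` has `x(0.5) ∈ [0.0589367, 0.3025851] × [2.23366, 2.327983]`.
[cite: Moore1979, §8.1 eqs. (8.6), (8.13)] -/
theorem mooreVolterraChain_final {z : ℝ → Fin 2 → ℝ} (hz0 : z 0 = ![1, 3])
    (hz : ∀ t ∈ Icc (0 : ℝ) (1 / 2),
      HasDerivWithinAt z (evalVec (fieldMv volterraField) (z t)) (Icc (0 : ℝ) (1 / 2)) t) :
    z (1 / 2) ∈ boxSet (castBox mooreVolterraChain.final) := by
  have h := fun hz' => HOEChainCert.mem_final mooreVolterraChain_check mooreVolterraChain_init_mem hz0 hz'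
  rw [mooreVolterraChain_size, mooreVolterraChain_mesh] at h
  exact h hz

end MooreExampleChain

end Literature.Analysis.ODE
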